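import Literature.MathematicalPhysics.QuantumFieldTheory.Balaban1983to89.B9CoReadingCoordsS
import Literature.MathematicalPhysics.QuantumFieldTheory.Balaban1983to89.B9RWSums346SecondDiff

/-!
# `Balaban1983to89.B9CoReadingCoordsL2S` — the (3.46) co-readings `L2ReadsNbr` (n06-k) of def-Y's SITE-sector reading `kernelFamilyS` (the G′(U) side,
# Theorem 3.7 ∕ row 18) HOLD on n06-d's site coordinate models `GcoS ∕ DcoS ∕ DscoS` (members 0, 1, 2) and on the pair families over the single-direction
# site letters `DdS ∕ DsdS` (members 3, 4, 5) — every letter, every `U`, block map carrier-∕1-faithful, radius `r ≥ 2`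

T. Bałaban, *Propagators for lattice gauge theories in a background field*, Commun. Math. Phys. **99** (1985) 389–434
[`Balaban1985BackgroundPropagators`, "B9"], (3.46) p. 398 (*"‖hG′(U)λ‖, ‖h∇_UG′(U)λ‖, ‖hG′(U)∇\*_Uλ‖, ‖h∇_UG′(U)∇\*_Uλ‖, ‖h∇_U∇_UG′(U)λ‖, ‖hG′(U)∇\*_U∇\*_Uλ‖ ≦ …
supp h ⊂ Δ(y), supp λ ⊂ Δ(y′)"*), (3.39) + (3.41)–(3.42) p. 397 (the `η², η` prefactors of the site sector); [4] = T. Bałaban, *Propagators and renormalization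
transformations for lattice gauge theories. II*, Commun. Math. Phys. **96** (1984) 223–250 [`Balaban1984PropagatorsII`], (2.51)–(2.52) p. 232, (2.54) p. 233,
(2.67) p. 234.

statement-level skeleton of published theorems with citation tags; proofs where landed; nothing here is a claim about the
Yang–Mills mass gap

WHY THIS FILE (dag-n06-d g5's division of the coordinate side, pub-ymgap INBOX 2026-08-27 l.18730 «YOU keep the L² engines»; seat n06-k g9).  In the N06
certificate of record (`…N06AtOpsYNuOfRecordV6EPair`, p521819) the row-18 walk letters of G′(U) are pinned to n06-d's SITE coordinate models
(`B9CoReadingCoordsS`: carrier `XSK κ i`, evaluation `evSK`, block map `blkSK (sIK bI)`, letters `GcoS = (η²·cR39) • coordOpK (O)`, `DcoS ∕ DscoS = η⁻¹ • coordOpK (∇ ∕ ∇\*)`)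
and ALL SIX (3.46) co-readings `hl0 … hl5` of the kernel family `kernelFamilyS` stay displayed.  THIS FILE discharges them — the site twin of
`B9CoReadingCoordsL2` (lines 0–2) and `B9CoReadingCoordsL2Pair` (lines 3–5; the two files are independent):

* §1 site cores: `bsq_evSK_le` ∕ `l2bound_evSK` (the `l2bound` field with `Cev := √((d+1)|κ|)`), `sum_nbr_bsq_eqS`, ★ `l2OfY_le_of_coordModelS` (THE CORE OF `obs`,
  from n06-d's pointwise `B9CoReadingCoordsS.norm_le_of_coordModelK_le_at`, 1-FAITHFUL `sI` + (2.54), √Σ ≦ Σ√) and its SCALED form ★ `l2OfY_le_of_coordModelS_scaled`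
  (model `(s·cR39) • coordOpK T`, `0 < s` ⇒ member ≦ c ∕ s — print's prefactors `η², η`), `sIK_dist_le_one` (1-faithfulness of `sIK bI` from that of `bI`), the
  pair composites `pairS3_eq ∕ pairS4_eq ∕ pairS5_eq` (prefactors collapse to `cR39`, as in n06-d's `DcoS_comp_GcoS`).
* §2 ★★ `l2ReadsNbr_kernelFamilyS_coords_zero ∕ one ∕ two ∕ three ∕ four ∕ five` and the knit's one-liners ★★ `site_l2ReadsNbr012_of_pins` ∕ ★★ `site_l2ReadsNbr345_of_pins`
  (letters with their pin equations, radius 2; the `DdS ∕ DsdS` bodies `(etaS i)⁻¹ • coordOpK b (fun _ => ∇_{U,μ} ∕ ∇\*_{U,μ})` quoted UNFOLDED — n06-d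
  `B9CoReadingCoordsDir`, INTENT-17).

HONEST SCOPE.  Finite-dimensional bookkeeping over def-Y's readings, n06-d's coordinate gadgets and this seat's `familyOp`; nothing of [B9] or [4] asserted; the
Hölder and input co-readings are NOT treated.  COUNT-NEUTRAL; N06 NOT discharged; one finite 𝕋^{d+1} programme at fixed ε — nothing continuum, nothing about the
mass gap.  Cell `pub-ymgap` (HUMAN RULING D-0062), Track A node N06 [B9], N06-ASSIGNMENT v1 bundle F6 (rows 18–19), seat `pub-ymgap-dag-n06-k` (gen 9), 2026-08-27.
-/

noncomputable section

namespace Literature.MathematicalPhysics.QuantumFieldTheory.Balaban1983to89.B9CoReadingCoordsL2S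

open B6GlobalChartV1 (PV domT blkV1 boxEquiv)
open B6Geom246MultiLevelBox (bset blkOf)
open B6Geom246MultiLevelTorus (geomT triangle_refl_nonneg_T)
open B6Ineq2142KLevelV1 (β)
open B6KLevelCensusIndexV1 (KIdx)
open B9GeoNormsKLevelV1 (geo9K geo9K_l2Norm_nonneg geo9K_cutSup_nonneg)
open B9GeoLemma21KLevelV1 (one_le_Mh one_le_P)
open B9Thm34Ext (toB6)
open B9SectDL2Decay (bl2 bsq bsq_nonneg bl2_nonneg bl2_smul)
open B9CoRealizesRelAtLetters (RelB)
open B9RWSumsReadsNbr (nbr mem_nbr L2ReadsNbr)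
open B9RWSums346SecondDiff (familyOp bsq_familyOp)
open B9Ineq349SiteComposite (cdSL cdsSL etaS_pos)
open B9Thm39ReadingCoords (cR39)
open B9CoReadingCoords (evDiagK coordOpK coordOpK_comp)
open B9CoReadingCoordsS (norm_le_of_coordModelK_le_at XSK evSK blkSK sIK blkV1_site GcoS DcoS DscoS DcoS_comp_GcoS GcoS_comp_DscoS off_bound_evSK)
open Node00 (SiteY FBondY IBondY CfgY BallY liftY l2OfY etaS kernelFamilyS SiteOpY SiteParY cdS cdsS iSup_ball_le)

variable {d ℓ : ℕ} {hd : 1 ≤ d + 1} {hL : Odd (ℓ + 1) ∧ 1 < ℓ + 1} {b₀ b₁ : ℝ}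
variable {𝔸 : Type} [NormedRing 𝔸] [NormedAlgebra ℂ 𝔸] [CompleteSpace 𝔸] [FiniteDimensional ℝ 𝔸]
variable {κ : Type} [Fintype κ] [DecidableEq κ]

/-! ## §1 Site cores -/

section Cores

variable (i : KIdx d ℓ hd hL b₀ b₁) (b : Module.Basis κ ℝ 𝔸) {R : ℝ} {H : Prop}

omit [Fintype κ] in
/-- on site arguments the site evaluation IS the diagonal evaluation. [cite: Balaban1985BackgroundPropagators, (3.42) p.397, bookkeeping] -/
private theorem evSK_inl (f : SiteY i → ℝ) : evSK (κ := κ) i (Sum.inl f) = evDiagK f := rfl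

/-- one member of a family against the package, weighted neighbourhood-sum form (the sibling `B9CoReadingCoordsL2Pair.sum_bl2_member_mul_le`, restated
privately so that the two files do not depend on each other). [cite: Balaban1985BackgroundPropagators, (3.39) p.397 («max_{μ,ν}») + (3.46) p.398, bookkeeping] -/
private theorem sum_bl2_member_mul_le' {g : B9.Geometry} [Fintype g.Site] {R' : ℝ} {H' : Prop} {u v P : Type} [Fintype u] [Fintype P]
    (bu : u → g.Site) (T : P → ((v → ℝ) →ₗ[ℝ] (u → ℝ))) (f : v → ℝ) (s : Finset g.Site) {S : ℝ} (hS : 0 ≤ S) (p : P) :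
    (∑ y'' ∈ s, bl2 (g := toB6 g R' H') bu y'' (T p f)) * S ≤ (∑ y'' ∈ s, bl2 (g := toB6 g R' H') (bu ∘ Prod.fst) y'' (familyOp T f)) * S := by
  refine mul_le_mul_of_nonneg_right (Finset.sum_le_sum fun y'' _ => ?_) hS
  unfold bl2
  refine Real.sqrt_le_sqrt ?_
  rw [bsq_familyOp]
  exact Finset.single_le_sum (f := fun q => bsq (g := toB6 g R' H') bu y'' (T q f)) (fun q _ => bsq_nonneg _ _ _) (Finset.mem_univ p)

/-- `Σ aᵢ² ≤ (Σ aᵢ)²` for non-negative terms. [folklore] -/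
private theorem sq_sum_le_sq_sum' {ι : Type} (s : Finset ι) (f : ι → ℝ) (hf : ∀ j, 0 ≤ f j) :
    ∑ j ∈ s, f j ^ 2 ≤ (∑ j ∈ s, f j) ^ 2 := by
  rw [sq, Finset.sum_mul_sum]
  refine Finset.sum_le_sum fun j hj => ?_
  rw [sq, ← Finset.mul_sum]
  exact mul_le_mul_of_nonneg_left (Finset.single_le_sum (fun k _ => hf k) hj) (hf j)

/-- `√(Σ aᵢ) ≤ Σ √aᵢ` for non-negative terms. [folklore] -/
private theorem sqrt_sum_le_sum_sqrt {ι : Type} (s : Finset ι) (a : ι → ℝ) (ha : ∀ j, 0 ≤ a j) :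
    Real.sqrt (∑ j ∈ s, a j) ≤ ∑ j ∈ s, Real.sqrt (a j) := by
  have h1 : ∑ j ∈ s, a j = ∑ j ∈ s, Real.sqrt (a j) ^ 2 :=
    Finset.sum_congr rfl fun j _ => (Real.sq_sqrt (ha j)).symm
  rw [h1]
  calc Real.sqrt (∑ j ∈ s, Real.sqrt (a j) ^ 2) ≤ Real.sqrt ((∑ j ∈ s, Real.sqrt (a j)) ^ 2) :=
        Real.sqrt_le_sqrt (sq_sum_le_sq_sum' s _ fun j => Real.sqrt_nonneg _)
    _ = ∑ j ∈ s, Real.sqrt (a j) := Real.sqrt_sq (Finset.sum_nonneg fun j _ => Real.sqrt_nonneg _)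

/-- ★ **THE FIBRE SQUARE-SIZE OF THE SITE DIAGONAL EVALUATION** is at most `(d+1)·|κ|·Σ f²`. [cite: Balaban1985BackgroundPropagators, (3.41)–(3.42) p.397 + (3.46) p.398 («‖λ‖»), bookkeeping] -/
theorem bsq_evSK_le [Fintype (geo9K i).Site] (sI : SiteY i → IBondY i) (f : SiteY i → ℝ) (y'' : IBondY i) :
    bsq (g := toB6 (geo9K i) R H) (blkSK (κ := κ) i sI) y'' (evDiagK f) ≤ ((d + 1) * Fintype.card κ : ℝ) * ∑ z, f z ^ 2 := by
  classical
  have h2 : ∑ p : XSK κ i, (if p.2.2.1 = p.2.2.2 then f p.1 ^ 2 else (0 : ℝ)) = ((d + 1) * Fintype.card κ : ℝ) * ∑ z, f z ^ 2 := by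
    calc ∑ p : XSK κ i, (if p.2.2.1 = p.2.2.2 then f p.1 ^ 2 else (0 : ℝ))
        = ∑ z : SiteY i, ∑ ν : Fin (d + 1), ∑ a : κ, ∑ c' : κ, (if a = c' then f z ^ 2 else (0 : ℝ)) := by
          rw [Fintype.sum_prod_type]
          refine Finset.sum_congr rfl fun z _ => ?_
          rw [Fintype.sum_prod_type]
          refine Finset.sum_congr rfl fun ν _ => ?_
          rw [Fintype.sum_prod_type]
      _ = ∑ z : SiteY i, ((d + 1) * Fintype.card κ : ℝ) * f z ^ 2 := by
          refine Finset.sum_congr rfl fun z _ => ?_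
          simp only [Finset.sum_ite_eq, Finset.mem_univ, if_true, Finset.sum_const, Finset.card_univ, Fintype.card_fin, nsmul_eq_mul]
          push_cast
          ring
      _ = ((d + 1) * Fintype.card κ : ℝ) * ∑ z, f z ^ 2 := by rw [Finset.mul_sum]
  unfold bsq
  refine le_trans (Finset.sum_le_sum fun p _ => ?_) h2.le
  unfold evDiagK
  split_ifs <;> first | exact le_rfl | positivity | simp

/-- the fields `l2bound` (with `Cev := √((d+1)·|κ|)`), on the site carrier. [cite: Balaban1985BackgroundPropagators, (3.46) p.398 («‖λ‖»), bookkeeping] -/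
theorem l2bound_evSK [Fintype (geo9K i).Site] (sI : SiteY i → IBondY i) (lam : (geo9K i).Loc) (y'' : IBondY i) :
    bl2 (g := toB6 (geo9K i) R H) (blkSK (κ := κ) i sI) y'' (evSK i lam) ≤
      Real.sqrt ((d + 1) * Fintype.card κ) * (geo9K i).l2Norm lam := by
  cases lam with
  | inr J =>
      have h0 : bl2 (g := toB6 (geo9K i) R H) (blkSK (κ := κ) i sI) y'' (evSK i (Sum.inr J)) = 0 := by
        show bl2 (g := toB6 (geo9K i) R H) (blkSK (κ := κ) i sI) y'' (fun _ => 0) = 0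
        exact B9SectDL2Decay.bl2_zero _ _
      rw [h0]
      exact mul_nonneg (Real.sqrt_nonneg _) (geo9K_l2Norm_nonneg i _)
  | inl f =>
      show Real.sqrt (bsq (g := toB6 (geo9K i) R H) (blkSK (κ := κ) i sI) y'' (evDiagK f)) ≤
        Real.sqrt ((d + 1) * Fintype.card κ) * Real.sqrt (∑ z, f z ^ 2)
      rw [← Real.sqrt_mul (by positivity)]
      exact Real.sqrt_le_sqrt (bsq_evSK_le i sI f y'')

omit [DecidableEq κ] in
/-- the neighbourhood sum of the fibre square-sizes is the sum over the site carrier points whose index bond lies in the neighbourhood.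
[cite: Balaban1984PropagatorsII, (2.45) p.231 (the blocks partition), bookkeeping] -/
theorem sum_nbr_bsq_eqS [Fintype (geo9K i).Site] (sI : SiteY i → IBondY i) (F : XSK κ i → ℝ) (s : Finset (IBondY i)) :
    ∑ y'' ∈ s, bsq (g := toB6 (geo9K i) R H) (blkSK (κ := κ) i sI) y'' F = ∑ p : XSK κ i, (if sI p.1 ∈ s then F p ^ 2 else 0) := by
  classical
  unfold bsq
  rw [Finset.sum_comm]
  refine Finset.sum_congr rfl fun p _ => ?_
  by_cases hp : sI p.1 ∈ s
  · rw [if_pos hp]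
    exact (Finset.sum_eq_single_of_mem (sI p.1) hp fun x _ hx => if_neg fun h : sI p.1 = x => hx h.symm).trans (if_pos rfl)
  · rw [if_neg hp]
    exact Finset.sum_eq_zero fun x hx => if_neg (fun h : sI p.1 = x => hp (by rw [h]; exact hx))

/-- **1-faithfulness on sites from 1-faithfulness on bonds**: the index bond `sIK bI z` lies within block distance 1 of the block of `z`.
[cite: Balaban1984PropagatorsII, (2.45) p.231 + p.248 («sites replaced by bonds»), bookkeeping] -/
theorem sIK_dist_le_one {bI : FBondY i → IBondY i} (hβ1 : ∀ x : FBondY i, (geomT i.D).dist (β i.hN i.D i.hk (bI x)) (blkV1 i.hN i.D x) ≤ 1)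
    (z : SiteY i) : (geomT i.D).dist (β i.hN i.D i.hk (sIK i bI z)) (blkOf i.D.toDomains z) ≤ 1 := by
  rw [← blkV1_site i z]
  exact hβ1 _

/-- ★ **THE CORE OF `obs` ON THE SITE CARRIER**: `sI` 1-faithful, `2 ≤ r`; if (Σ over the index bonds y″ with `d(y″, y) ≤ r` of the fibre-L² sizes of the
`cR39`-scaled coordinate model of `T` at the diagonal evaluation of `f`)·|hh| ≦ c and every site where `hh ≠ 0` lies within block distance 1 of `β y`, then
`‖hh · (T ν (f ⊗ E))‖₂ ≤ c` for `‖E‖ ≤ 1` and every slot `ν`. [cite: Balaban1985BackgroundPropagators, (3.46) p.398 + (3.41)–(3.42) p.397; Balaban1984PropagatorsII, (2.51)–(2.52) p.232 + (2.54) p.233] -/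
theorem l2OfY_le_of_coordModelS [Fintype (geo9K i).Site] {sI : SiteY i → IBondY i}
    (hσ1 : ∀ z : SiteY i, (geomT i.D).dist (β i.hN i.D i.hk (sI z)) (blkOf i.D.toDomains z) ≤ 1) {r : ℝ} (hr : 2 ≤ r)
    (T : Fin (d + 1) → (SiteY i → 𝔸) →ₗ[ℝ] (SiteY i → 𝔸)) (f : SiteY i → ℝ) (hh : SiteY i → ℝ) (y : IBondY i) {c : ℝ}
    (hcut : ∀ z, hh z ≠ 0 → (geomT i.D).dist (blkOf i.D.toDomains z) (β i.hN i.D i.hk y) ≤ 1)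
    (hx : (∑ y'' ∈ nbr (geo9K i) r y, bl2 (g := toB6 (geo9K i) R H) (blkSK i sI) y'' ((cR39 b • coordOpK b T) (evDiagK f))) *
      (⨆ z, |hh z|) ≤ c)
    (E : BallY 𝔸) (ν : Fin (d + 1)) : l2OfY hh (T ν (liftY f (E : 𝔸))) ≤ c := by
  classical
  set F : XSK κ i → ℝ := (cR39 b • coordOpK b T) (evDiagK f) with hF
  set S : ℝ := ⨆ z, |hh z| with hS
  have hE : ‖(E : 𝔸)‖ ≤ 1 := mem_closedBall_zero_iff.1 E.2
  have hS0 : 0 ≤ S := Real.iSup_nonneg fun _ => abs_nonneg _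
  have hSx : ∀ z, |hh z| ≤ S := fun z => le_ciSup (f := fun w => |hh w|) (Finite.bddAbove_range _) z
  set g : SiteY i → ℝ := fun z => Real.sqrt (∑ q : Fin (d + 1) × κ × κ, F (z, q) ^ 2) with hg
  have hg0 : ∀ z, 0 ≤ g z := fun z => Real.sqrt_nonneg _
  have hpt : ∀ z, ‖T ν (liftY f (E : 𝔸)) z‖ ≤ g z := by
    intro z
    refine norm_le_of_coordModelK_le_at b T f z (hg0 z) (fun ν' cc cc' => ?_) hE ν
    show |F (z, ν', cc, cc')| ≤ g z
    refine Real.abs_le_sqrt ?_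
    exact Finset.single_le_sum (f := fun q : Fin (d + 1) × κ × κ => F (z, q) ^ 2) (fun q _ => sq_nonneg _)
      (Finset.mem_univ (ν', cc, cc'))
  have hterm : ∀ z, (hh z * ‖T ν (liftY f (E : 𝔸)) z‖) ^ 2 ≤ S ^ 2 * (if hh z = 0 then 0 else g z ^ 2) := by
    intro z
    by_cases h0 : hh z = 0
    · rw [h0, if_pos rfl]; simp
    · rw [if_neg h0, mul_pow]
      exact mul_le_mul (by rw [← sq_abs]; exact pow_le_pow_left₀ (abs_nonneg _) (hSx z) 2)
        (pow_le_pow_left₀ (norm_nonneg _) (hpt z) 2) (sq_nonneg _) (sq_nonneg _)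
  have hmem : ∀ z, hh z ≠ 0 → sI z ∈ nbr (geo9K i) r y := by
    intro z hz0
    refine mem_nbr.2 ?_
    show (geomT i.D).dist (β i.hN i.D i.hk (sI z)) (β i.hN i.D i.hk y) ≤ r
    have htri := (triangle_refl_nonneg_T i.D (one_le_Mh i) (one_le_P i)).1
      (β i.hN i.D i.hk (sI z)) (blkOf i.D.toDomains z) (β i.hN i.D i.hk y)
    linarith [hσ1 z, hcut z hz0]
  have hsum : ∑ z, (if hh z = 0 then 0 else g z ^ 2) ≤
      ∑ y'' ∈ nbr (geo9K i) r y, bsq (g := toB6 (geo9K i) R H) (blkSK (κ := κ) i sI) y'' F := by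
    refine le_of_le_of_eq ?_ (sum_nbr_bsq_eqS (R := R) (H := H) (κ := κ) i sI F (nbr (geo9K i) r y)).symm
    have hrw : ∀ z, (if hh z = 0 then 0 else g z ^ 2) = ∑ q : Fin (d + 1) × κ × κ, (if hh z = 0 then 0 else F (z, q) ^ 2) := by
      intro z
      by_cases h0 : hh z = 0
      · simp [h0]
      · simp only [if_neg h0, hg]
        rw [Real.sq_sqrt (Finset.sum_nonneg fun q _ => sq_nonneg _)]
    rw [Finset.sum_congr rfl fun z _ => hrw z, ← Fintype.sum_prod_type']
    refine Finset.sum_le_sum fun p _ => ?_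
    by_cases h0 : hh p.1 = 0
    · rw [if_pos h0]; split_ifs <;> positivity
    · rw [if_neg h0]
      exact (if_pos (hmem p.1 h0)).symm.le
  have hl2sq : ∑ z, (hh z * ‖T ν (liftY f (E : 𝔸)) z‖) ^ 2 ≤
      S ^ 2 * ∑ y'' ∈ nbr (geo9K i) r y, bsq (g := toB6 (geo9K i) R H) (blkSK (κ := κ) i sI) y'' F := by
    calc ∑ z, (hh z * ‖T ν (liftY f (E : 𝔸)) z‖) ^ 2 ≤ ∑ z, S ^ 2 * (if hh z = 0 then 0 else g z ^ 2) :=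
          Finset.sum_le_sum fun z _ => hterm z
      _ = S ^ 2 * ∑ z, (if hh z = 0 then 0 else g z ^ 2) := by rw [Finset.mul_sum]
      _ ≤ S ^ 2 * ∑ y'' ∈ nbr (geo9K i) r y, bsq (g := toB6 (geo9K i) R H) (blkSK (κ := κ) i sI) y'' F :=
          mul_le_mul_of_nonneg_left hsum (sq_nonneg _)
  have hB0 : 0 ≤ ∑ y'' ∈ nbr (geo9K i) r y, bsq (g := toB6 (geo9K i) R H) (blkSK (κ := κ) i sI) y'' F :=
    Finset.sum_nonneg fun y'' _ => bsq_nonneg _ _ _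
  unfold l2OfY
  calc Real.sqrt (∑ z, (hh z * ‖T ν (liftY f (E : 𝔸)) z‖) ^ 2)
      ≤ Real.sqrt (S ^ 2 * ∑ y'' ∈ nbr (geo9K i) r y, bsq (g := toB6 (geo9K i) R H) (blkSK (κ := κ) i sI) y'' F) :=
        Real.sqrt_le_sqrt hl2sq
    _ = S * Real.sqrt (∑ y'' ∈ nbr (geo9K i) r y, bsq (g := toB6 (geo9K i) R H) (blkSK (κ := κ) i sI) y'' F) := by
        rw [Real.sqrt_mul (sq_nonneg _), Real.sqrt_sq hS0]
    _ ≤ S * ∑ y'' ∈ nbr (geo9K i) r y, bl2 (g := toB6 (geo9K i) R H) (blkSK (κ := κ) i sI) y'' F := by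
        refine mul_le_mul_of_nonneg_left ?_ hS0
        unfold bl2
        exact sqrt_sum_le_sum_sqrt _ _ fun y'' => bsq_nonneg _ _ _
    _ = (∑ y'' ∈ nbr (geo9K i) r y, bl2 (g := toB6 (geo9K i) R H) (blkSK (κ := κ) i sI) y'' F) * S := mul_comm _ _
    _ ≤ c := hx

/-- ★ **THE SCALED CORE** (print's prefactors `η², η` of the site sector): if the model is `(s·cR39) • coordOpK T` with `0 < s`, the member is `≦ c ∕ s`.
[cite: Balaban1985BackgroundPropagators, (3.46) p.398 + (3.41)–(3.42) p.397; Balaban1984PropagatorsII, (2.67) p.234 (the prefactors)] -/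
theorem l2OfY_le_of_coordModelS_scaled [Fintype (geo9K i).Site] {sI : SiteY i → IBondY i}
    (hσ1 : ∀ z : SiteY i, (geomT i.D).dist (β i.hN i.D i.hk (sI z)) (blkOf i.D.toDomains z) ≤ 1) {r : ℝ} (hr : 2 ≤ r)
    (T : Fin (d + 1) → (SiteY i → 𝔸) →ₗ[ℝ] (SiteY i → 𝔸)) (f : SiteY i → ℝ) (hh : SiteY i → ℝ) (y : IBondY i) {c : ℝ}
    (hcut : ∀ z, hh z ≠ 0 → (geomT i.D).dist (blkOf i.D.toDomains z) (β i.hN i.D i.hk y) ≤ 1) {s : ℝ} (hs : 0 < s)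
    (hx : (∑ y'' ∈ nbr (geo9K i) r y, bl2 (g := toB6 (geo9K i) R H) (blkSK i sI) y'' (((s * cR39 b) • coordOpK b T) (evDiagK f))) *
      (⨆ z, |hh z|) ≤ c)
    (E : BallY 𝔸) (ν : Fin (d + 1)) : l2OfY hh (T ν (liftY f (E : 𝔸))) ≤ c / s := by
  refine l2OfY_le_of_coordModelS (R := R) (H := H) i b hσ1 hr T f hh y hcut ?_ E ν
  have hsm : ((s * cR39 b) • coordOpK b T) (evDiagK f) = s • ((cR39 b • coordOpK b T) (evDiagK f)) := by
    rw [mul_smul, LinearMap.smul_apply]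
  have hrw : (∑ y'' ∈ nbr (geo9K i) r y, bl2 (g := toB6 (geo9K i) R H) (blkSK (κ := κ) i sI) y'' (((s * cR39 b) • coordOpK b T) (evDiagK f))) =
      s * ∑ y'' ∈ nbr (geo9K i) r y, bl2 (g := toB6 (geo9K i) R H) (blkSK (κ := κ) i sI) y'' ((cR39 b • coordOpK b T) (evDiagK f)) := by
    rw [hsm, Finset.mul_sum]
    exact Finset.sum_congr rfl fun y'' _ => by rw [bl2_smul, abs_of_pos hs]
  rw [hrw, mul_assoc] at hx
  exact (le_div_iff₀' hs).2 hx

variable (B : B9.Backgrounds) (cfg : B.Cfg → CfgY 𝔸 i) (O : SiteOpY 𝔸 i)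

omit [DecidableEq κ] in
/-- the MIXED site pair member `DdS ν ∘ (GcoS ∘ DsdS μ)` IS the `cR39`-scaled coordinate model of `∇_{U,ν} ∘ O(U) ∘ ∇\*_{U,μ}` (prefactors `η⁻¹·η²·η⁻¹ = 1`).
[cite: Balaban1985BackgroundPropagators, (3.46) p.398 (∇_UG′∇\*_U), (3.42) p.397; Balaban1984PropagatorsII, (2.67) p.234, bookkeeping] -/
theorem pairS3_eq (U₁ : B.Cfg) (ν μ : Fin (d + 1)) :
    ((etaS i)⁻¹ • coordOpK b (fun _ : Fin (d + 1) => (cdSL i (cfg U₁) ν).restrictScalars ℝ)) ∘ₗ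
        (GcoS i b B cfg O U₁ ∘ₗ ((etaS i)⁻¹ • coordOpK b (fun _ : Fin (d + 1) => (cdsSL i (cfg U₁) μ).restrictScalars ℝ))) =
      cR39 b • coordOpK b (fun _ : Fin (d + 1) =>
        (cdSL i (cfg U₁) ν).restrictScalars ℝ ∘ₗ ((O (cfg U₁)).restrictScalars ℝ ∘ₗ (cdsSL i (cfg U₁) μ).restrictScalars ℝ)) := by
  have hs : (etaS i)⁻¹ * (etaS i ^ 2 * cR39 b) * (etaS i)⁻¹ = cR39 b := by
    rw [pow_two]; field_simp [(etaS_pos i).ne']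
  simp only [GcoS, LinearMap.smul_comp, LinearMap.comp_smul, coordOpK_comp, smul_smul, hs]

omit [DecidableEq κ] in
/-- the site pair member `(DdS ν ∘ DdS μ) ∘ GcoS` IS the `cR39`-scaled coordinate model of `∇_{U,ν}∇_{U,μ} ∘ O(U)`.
[cite: Balaban1985BackgroundPropagators, (3.46) p.398 (∇_U∇_UG′), (3.42) p.397; Balaban1984PropagatorsII, (2.67) p.234, bookkeeping] -/
theorem pairS4_eq (U₁ : B.Cfg) (ν μ : Fin (d + 1)) :
    (((etaS i)⁻¹ • coordOpK b (fun _ : Fin (d + 1) => (cdSL i (cfg U₁) ν).restrictScalars ℝ)) ∘ₗ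
        ((etaS i)⁻¹ • coordOpK b (fun _ : Fin (d + 1) => (cdSL i (cfg U₁) μ).restrictScalars ℝ))) ∘ₗ GcoS i b B cfg O U₁ =
      cR39 b • coordOpK b (fun _ : Fin (d + 1) =>
        ((cdSL i (cfg U₁) ν).restrictScalars ℝ ∘ₗ (cdSL i (cfg U₁) μ).restrictScalars ℝ) ∘ₗ (O (cfg U₁)).restrictScalars ℝ) := by
  have hs : etaS i ^ 2 * cR39 b * ((etaS i)⁻¹ * (etaS i)⁻¹) = cR39 b := by
    rw [pow_two]; field_simp [(etaS_pos i).ne']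
  simp only [GcoS, LinearMap.smul_comp, LinearMap.comp_smul, coordOpK_comp, smul_smul, hs]

omit [DecidableEq κ] in
/-- the site pair member `GcoS ∘ (DsdS ν ∘ DsdS μ)` IS the `cR39`-scaled coordinate model of `O(U) ∘ ∇\*_{U,ν}∇\*_{U,μ}`.
[cite: Balaban1985BackgroundPropagators, (3.46) p.398 (G′∇\*_U∇\*_U), (3.42) p.397; Balaban1984PropagatorsII, (2.67) p.234, bookkeeping] -/
theorem pairS5_eq (U₁ : B.Cfg) (ν μ : Fin (d + 1)) :
    GcoS i b B cfg O U₁ ∘ₗ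
        (((etaS i)⁻¹ • coordOpK b (fun _ : Fin (d + 1) => (cdsSL i (cfg U₁) ν).restrictScalars ℝ)) ∘ₗ
          ((etaS i)⁻¹ • coordOpK b (fun _ : Fin (d + 1) => (cdsSL i (cfg U₁) μ).restrictScalars ℝ))) =
      cR39 b • coordOpK b (fun _ : Fin (d + 1) =>
        (O (cfg U₁)).restrictScalars ℝ ∘ₗ ((cdsSL i (cfg U₁) ν).restrictScalars ℝ ∘ₗ (cdsSL i (cfg U₁) μ).restrictScalars ℝ)) := by
  have hs : (etaS i)⁻¹ * (etaS i)⁻¹ * (etaS i ^ 2 * cR39 b) = cR39 b := by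
    rw [pow_two]; field_simp [(etaS_pos i).ne']
  simp only [GcoS, LinearMap.smul_comp, LinearMap.comp_smul, coordOpK_comp, smul_smul, hs]

/-- entry 0 of a 6-vector. [folklore] -/
private theorem vec6_zero {α : Type} (a0 a1 a2 a3 a4 a5 : α) : (![a0, a1, a2, a3, a4, a5] : Fin 6 → α) 0 = a0 := rfl
/-- entry 1 of a 6-vector. [folklore] -/
private theorem vec6_one {α : Type} (a0 a1 a2 a3 a4 a5 : α) : (![a0, a1, a2, a3, a4, a5] : Fin 6 → α) 1 = a1 := rfl
/-- entry 2 of a 6-vector. [folklore] -/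
private theorem vec6_two {α : Type} (a0 a1 a2 a3 a4 a5 : α) : (![a0, a1, a2, a3, a4, a5] : Fin 6 → α) 2 = a2 := rfl
/-- entry 3 of a 6-vector. [folklore] -/
private theorem vec6_three {α : Type} (a0 a1 a2 a3 a4 a5 : α) : (![a0, a1, a2, a3, a4, a5] : Fin 6 → α) 3 = a3 := rfl
/-- entry 4 of a 6-vector. [folklore] -/
private theorem vec6_four {α : Type} (a0 a1 a2 a3 a4 a5 : α) : (![a0, a1, a2, a3, a4, a5] : Fin 6 → α) 4 = a4 := rfl
/-- entry 5 of a 6-vector. [folklore] -/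
private theorem vec6_five {α : Type} (a0 a1 a2 a3 a4 a5 : α) : (![a0, a1, a2, a3, a4, a5] : Fin 6 → α) 5 = a5 := rfl

end Cores

/-! ## §2 ★★ The (3.46) co-readings of `kernelFamilyS` on the site coordinate models, entries 0 – 5 -/

section L2

variable (i : KIdx d ℓ hd hL b₀ b₁) (b : Module.Basis κ ℝ 𝔸) (B : B9.Backgrounds) (cfg : B.Cfg → CfgY 𝔸 i) (O : SiteOpY 𝔸 i)
  (par : SiteParY 𝔸 i) (U₁ : B.Cfg) {R : ℝ} {H : Prop}
variable {sI : SiteY i → IBondY i}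

/-- the common non-`obs` fields of the six site co-readings. [cite: Balaban1985BackgroundPropagators, (3.46) p.398, bookkeeping] -/
private theorem fields [Fintype (geo9K i).Site]
    (hσI : ∀ (z : SiteY i) (c : IBondY i), blkOf i.D.toDomains z = β i.hN i.D i.hk c → β i.hN i.D i.hk (sI z) = blkOf i.D.toDomains z) :
    (∀ (lam : (geo9K i).Loc) (y' : (geo9K i).Site), (geo9K i).suppIn lam y' → ∀ p : XSK κ i, ¬ RelB i (blkSK i sI p) y' → evSK i lam p = 0) ∧
    (∀ (lam : (geo9K i).Loc) (y' y'' : (geo9K i).Site), (geo9K i).suppIn lam y' → RelB i y'' y' →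
      bl2 (g := toB6 (geo9K i) R H) (blkSK (κ := κ) i sI) y'' (evSK i lam) ≤ Real.sqrt ((d + 1) * Fintype.card κ) * (geo9K i).l2Norm lam) ∧
    (∀ lam : (geo9K i).Loc, 0 ≤ (geo9K i).l2Norm lam) ∧ (∀ h : (geo9K i).Cut, 0 ≤ (geo9K i).cutSup h) :=
  ⟨(off_bound_evSK (κ := κ) i hσI).1, fun lam _ y'' _ _ => l2bound_evSK i sI lam y'', fun lam => geo9K_l2Norm_nonneg i lam,
    fun h => geo9K_cutSup_nonneg i h⟩

/-- the site cut-off condition `supp hh ⊂ Δ(y)` gives block distance `≤ 1`. [cite: Balaban1985BackgroundPropagators, (3.46) p.398 («supp h ⊂ Δ(y)»), bookkeeping] -/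
private theorem hcut_dist {hh : SiteY i → ℝ} {y : IBondY i} (hcut : ∀ z, hh z ≠ 0 → blkOf i.D.toDomains z = β i.hN i.D i.hk y) (z : SiteY i)
    (hz : hh z ≠ 0) : (geomT i.D).dist (blkOf i.D.toDomains z) (β i.hN i.D i.hk y) ≤ 1 := by
  rw [hcut z hz, (triangle_refl_nonneg_T i.D (one_le_Mh i) (one_le_P i)).2.1]
  norm_num

/-- ★★ **ENTRY 0 — `L2ReadsNbr (kernelFamilyS …) 0 U₁ (RelB i) r √((d+1)|κ|) (blkSK sI) (blkSK sI) evSK (GcoS …)`** for EVERY site-sector letter `O`, EVERY `U₁`, every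
real basis `b`, every radius `r ≥ 2`, given `sI` carrier-faithful on sites (`hσI`) and 1-faithful (`hσ1`): the member `η²‖hO(U)(f ⊗ E)‖₂` through the
`η²`-scaled model. [cite: Balaban1985BackgroundPropagators, (3.46) p.398 (first member) + (3.41)–(3.42) p.397; Balaban1984PropagatorsII, (2.51)–(2.52) p.232, (2.54) p.233, (2.67) p.234] -/
theorem l2ReadsNbr_kernelFamilyS_coords_zero [Fintype (geo9K i).Site] [DecidableRel (RelB i)]
    (hσI : ∀ (z : SiteY i) (c : IBondY i), blkOf i.D.toDomains z = β i.hN i.D i.hk c → β i.hN i.D i.hk (sI z) = blkOf i.D.toDomains z)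
    (hσ1 : ∀ z : SiteY i, (geomT i.D).dist (β i.hN i.D i.hk (sI z)) (blkOf i.D.toDomains z) ≤ 1) {r : ℝ} (hr : 2 ≤ r) :
    L2ReadsNbr (R := R) (H := H) (kernelFamilyS i B cfg O par) 0 U₁ (RelB i) r (Real.sqrt ((d + 1) * Fintype.card κ))
      (blkSK i sI) (blkSK i sI) (evSK i) (GcoS i b B cfg O U₁) := by
  obtain ⟨h1, h2, h3, h4⟩ := fields (R := R) (H := H) (κ := κ) i hσI
  refine ⟨h1, h2, h3, h4, ?_⟩
  intro lam h y c hc hcut hx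
  cases lam with
  | inr J => cases h with
    | inl z => exact hc
    | inr hh => exact hc
  | inl f => cases h with
    | inr hh => exact hc
    | inl hh =>
        have hη : 0 < etaS i ^ 2 := pow_pos (etaS_pos i) 2
        show etaS i ^ ((![2, 1, 1, 0, 0, 0] : Fin 6 → ℕ) 0) * (⨆ E : BallY 𝔸, ((![l2OfY hh (O (cfg U₁) (liftY f (E : 𝔸))),
            ⨆ μ : Fin (d + 1), l2OfY hh (cdS i (cfg U₁) μ (O (cfg U₁) (liftY f (E : 𝔸)))),
            ⨆ μ : Fin (d + 1), l2OfY hh (O (cfg U₁) (cdsS i (cfg U₁) μ (liftY f (E : 𝔸)))),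
            ⨆ μ : Fin (d + 1), ⨆ ν : Fin (d + 1), l2OfY hh (cdS i (cfg U₁) μ (O (cfg U₁) (cdsS i (cfg U₁) ν (liftY f (E : 𝔸))))),
            ⨆ μ : Fin (d + 1), ⨆ ν : Fin (d + 1), l2OfY hh (cdS i (cfg U₁) μ (cdS i (cfg U₁) ν (O (cfg U₁) (liftY f (E : 𝔸))))),
            ⨆ μ : Fin (d + 1), ⨆ ν : Fin (d + 1),
              l2OfY hh (O (cfg U₁) (cdsS i (cfg U₁) μ (cdsS i (cfg U₁) ν (liftY f (E : 𝔸)))))] : Fin 6 → ℝ) 0)) ≤ c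
        simp only [vec6_zero]
        rw [mul_comm, ← le_div_iff₀ hη]
        refine iSup_ball_le (fun E => ?_) (div_nonneg hc hη.le)
        rw [GcoS, evSK_inl] at hx
        exact l2OfY_le_of_coordModelS_scaled i b hσ1 hr (fun _ : Fin (d + 1) => (O (cfg U₁)).restrictScalars ℝ) f hh y
          (hcut_dist i hcut) hη hx E 0

/-- ★★ **ENTRY 1 — `L2ReadsNbr … 1 U₁ (RelB i) r √((d+1)|κ|) (blkSK sI) (blkSK sI) evSK (DcoS ∘ₗ GcoS)`**: the member `η·sup_μ ‖h∇_{U,μ}O(U)(f ⊗ E)‖₂`.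
[cite: Balaban1985BackgroundPropagators, (3.46) p.398 (second member); Balaban1984PropagatorsII, (2.51)–(2.52) p.232, (2.67) p.234] -/
theorem l2ReadsNbr_kernelFamilyS_coords_one [Fintype (geo9K i).Site] [DecidableRel (RelB i)]
    (hσI : ∀ (z : SiteY i) (c : IBondY i), blkOf i.D.toDomains z = β i.hN i.D i.hk c → β i.hN i.D i.hk (sI z) = blkOf i.D.toDomains z)
    (hσ1 : ∀ z : SiteY i, (geomT i.D).dist (β i.hN i.D i.hk (sI z)) (blkOf i.D.toDomains z) ≤ 1) {r : ℝ} (hr : 2 ≤ r) :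
    L2ReadsNbr (R := R) (H := H) (kernelFamilyS i B cfg O par) 1 U₁ (RelB i) r (Real.sqrt ((d + 1) * Fintype.card κ))
      (blkSK i sI) (blkSK i sI) (evSK i) (DcoS i b B cfg U₁ ∘ₗ GcoS i b B cfg O U₁) := by
  obtain ⟨h1, h2, h3, h4⟩ := fields (R := R) (H := H) (κ := κ) i hσI
  refine ⟨h1, h2, h3, h4, ?_⟩
  intro lam h y c hc hcut hx
  cases lam with
  | inr J => cases h with
    | inl z => exact hc
    | inr hh => exact hc
  | inl f => cases h with
    | inr hh => exact hc
    | inl hh =>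
        have hη : 0 < etaS i := etaS_pos i
        show etaS i ^ ((![2, 1, 1, 0, 0, 0] : Fin 6 → ℕ) 1) * (⨆ E : BallY 𝔸, ((![l2OfY hh (O (cfg U₁) (liftY f (E : 𝔸))),
            ⨆ μ : Fin (d + 1), l2OfY hh (cdS i (cfg U₁) μ (O (cfg U₁) (liftY f (E : 𝔸)))),
            ⨆ μ : Fin (d + 1), l2OfY hh (O (cfg U₁) (cdsS i (cfg U₁) μ (liftY f (E : 𝔸)))),
            ⨆ μ : Fin (d + 1), ⨆ ν : Fin (d + 1), l2OfY hh (cdS i (cfg U₁) μ (O (cfg U₁) (cdsS i (cfg U₁) ν (liftY f (E : 𝔸))))),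
            ⨆ μ : Fin (d + 1), ⨆ ν : Fin (d + 1), l2OfY hh (cdS i (cfg U₁) μ (cdS i (cfg U₁) ν (O (cfg U₁) (liftY f (E : 𝔸))))),
            ⨆ μ : Fin (d + 1), ⨆ ν : Fin (d + 1),
              l2OfY hh (O (cfg U₁) (cdsS i (cfg U₁) μ (cdsS i (cfg U₁) ν (liftY f (E : 𝔸)))))] : Fin 6 → ℝ) 1)) ≤ c
        simp only [vec6_one, pow_one]
        rw [mul_comm, ← le_div_iff₀ hη]
        refine iSup_ball_le (fun E => Real.iSup_le (fun μ => ?_) (div_nonneg hc hη.le)) (div_nonneg hc hη.le)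
        rw [DcoS_comp_GcoS, evSK_inl] at hx
        exact l2OfY_le_of_coordModelS_scaled i b hσ1 hr
          (fun ν => (cdSL i (cfg U₁) ν).restrictScalars ℝ ∘ₗ (O (cfg U₁)).restrictScalars ℝ) f hh y (hcut_dist i hcut) hη hx E μ

/-- ★★ **ENTRY 2 — `L2ReadsNbr … 2 U₁ (RelB i) r √((d+1)|κ|) (blkSK sI) (blkSK sI) evSK (GcoS ∘ₗ DscoS)`**: the member `η·sup_μ ‖hO(U)∇\*_{U,μ}(f ⊗ E)‖₂`.
[cite: Balaban1985BackgroundPropagators, (3.46) p.398 (third member); Balaban1984PropagatorsII, (2.51)–(2.52) p.232, (2.67) p.234] -/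
theorem l2ReadsNbr_kernelFamilyS_coords_two [Fintype (geo9K i).Site] [DecidableRel (RelB i)]
    (hσI : ∀ (z : SiteY i) (c : IBondY i), blkOf i.D.toDomains z = β i.hN i.D i.hk c → β i.hN i.D i.hk (sI z) = blkOf i.D.toDomains z)
    (hσ1 : ∀ z : SiteY i, (geomT i.D).dist (β i.hN i.D i.hk (sI z)) (blkOf i.D.toDomains z) ≤ 1) {r : ℝ} (hr : 2 ≤ r) :
    L2ReadsNbr (R := R) (H := H) (kernelFamilyS i B cfg O par) 2 U₁ (RelB i) r (Real.sqrt ((d + 1) * Fintype.card κ))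
      (blkSK i sI) (blkSK i sI) (evSK i) (GcoS i b B cfg O U₁ ∘ₗ DscoS i b B cfg U₁) := by
  obtain ⟨h1, h2, h3, h4⟩ := fields (R := R) (H := H) (κ := κ) i hσI
  refine ⟨h1, h2, h3, h4, ?_⟩
  intro lam h y c hc hcut hx
  cases lam with
  | inr J => cases h with
    | inl z => exact hc
    | inr hh => exact hc
  | inl f => cases h with
    | inr hh => exact hc
    | inl hh =>
        have hη : 0 < etaS i := etaS_pos i
        show etaS i ^ ((![2, 1, 1, 0, 0, 0] : Fin 6 → ℕ) 2) * (⨆ E : BallY 𝔸, ((![l2OfY hh (O (cfg U₁) (liftY f (E : 𝔸))),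
            ⨆ μ : Fin (d + 1), l2OfY hh (cdS i (cfg U₁) μ (O (cfg U₁) (liftY f (E : 𝔸)))),
            ⨆ μ : Fin (d + 1), l2OfY hh (O (cfg U₁) (cdsS i (cfg U₁) μ (liftY f (E : 𝔸)))),
            ⨆ μ : Fin (d + 1), ⨆ ν : Fin (d + 1), l2OfY hh (cdS i (cfg U₁) μ (O (cfg U₁) (cdsS i (cfg U₁) ν (liftY f (E : 𝔸))))),
            ⨆ μ : Fin (d + 1), ⨆ ν : Fin (d + 1), l2OfY hh (cdS i (cfg U₁) μ (cdS i (cfg U₁) ν (O (cfg U₁) (liftY f (E : 𝔸))))),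
            ⨆ μ : Fin (d + 1), ⨆ ν : Fin (d + 1),
              l2OfY hh (O (cfg U₁) (cdsS i (cfg U₁) μ (cdsS i (cfg U₁) ν (liftY f (E : 𝔸)))))] : Fin 6 → ℝ) 2)) ≤ c
        simp only [vec6_two, pow_one]
        rw [mul_comm, ← le_div_iff₀ hη]
        refine iSup_ball_le (fun E => Real.iSup_le (fun μ => ?_) (div_nonneg hc hη.le)) (div_nonneg hc hη.le)
        rw [GcoS_comp_DscoS, evSK_inl] at hx
        exact l2OfY_le_of_coordModelS_scaled i b hσ1 hr
          (fun ν => (O (cfg U₁)).restrictScalars ℝ ∘ₗ (cdsSL i (cfg U₁) ν).restrictScalars ℝ) f hh y (hcut_dist i hcut) hη hx E μ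

/-- ★★ **ENTRY 3 (MIXED) — `L2ReadsNbr … 3 U₁ (RelB i) r √((d+1)|κ|) (blkSK sI ∘ fst) (blkSK sI) evSK (familyOp fun p => DdS p.1 ∘ₗ (GcoS ∘ₗ DsdS p.2))`** at the
single-direction site letters `DdS μ = η⁻¹ • coordOpK (fun _ => ∇_{U,μ})`, `DsdS μ = η⁻¹ • coordOpK (fun _ => ∇\*_{U,μ})`: the member `sup_{μ,ν} ‖h∇_{U,μ}O∇\*_{U,ν}(f ⊗ E)‖₂`,
pair by pair, from the package. [cite: Balaban1985BackgroundPropagators, (3.46) p.398 (∇_UG′∇\*_U member) + (3.39) p.397; Balaban1984PropagatorsII, (2.51)–(2.52) p.232, (2.54) p.233] -/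
theorem l2ReadsNbr_kernelFamilyS_coords_three [Fintype (geo9K i).Site] [DecidableRel (RelB i)]
    (hσI : ∀ (z : SiteY i) (c : IBondY i), blkOf i.D.toDomains z = β i.hN i.D i.hk c → β i.hN i.D i.hk (sI z) = blkOf i.D.toDomains z)
    (hσ1 : ∀ z : SiteY i, (geomT i.D).dist (β i.hN i.D i.hk (sI z)) (blkOf i.D.toDomains z) ≤ 1) {r : ℝ} (hr : 2 ≤ r) :
    L2ReadsNbr (R := R) (H := H) (kernelFamilyS i B cfg O par) 3 U₁ (RelB i) r (Real.sqrt ((d + 1) * Fintype.card κ))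
      (blkSK i sI ∘ Prod.fst) (blkSK i sI) (evSK i)
      (familyOp fun p : Fin (d + 1) × Fin (d + 1) =>
        ((etaS i)⁻¹ • coordOpK b (fun _ : Fin (d + 1) => (cdSL i (cfg U₁) p.1).restrictScalars ℝ)) ∘ₗ
          (GcoS i b B cfg O U₁ ∘ₗ ((etaS i)⁻¹ • coordOpK b (fun _ : Fin (d + 1) => (cdsSL i (cfg U₁) p.2).restrictScalars ℝ)))) := by
  obtain ⟨h1, h2, h3, h4⟩ := fields (R := R) (H := H) (κ := κ) i hσI
  refine ⟨h1, h2, h3, h4, ?_⟩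
  intro lam h y c hc hcut hx
  cases lam with
  | inr J => cases h with
    | inl z => exact hc
    | inr hh => exact hc
  | inl f => cases h with
    | inr hh => exact hc
    | inl hh =>
        show etaS i ^ ((![2, 1, 1, 0, 0, 0] : Fin 6 → ℕ) 3) * (⨆ E : BallY 𝔸, ((![l2OfY hh (O (cfg U₁) (liftY f (E : 𝔸))),
            ⨆ μ : Fin (d + 1), l2OfY hh (cdS i (cfg U₁) μ (O (cfg U₁) (liftY f (E : 𝔸)))),
            ⨆ μ : Fin (d + 1), l2OfY hh (O (cfg U₁) (cdsS i (cfg U₁) μ (liftY f (E : 𝔸)))),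
            ⨆ μ : Fin (d + 1), ⨆ ν : Fin (d + 1), l2OfY hh (cdS i (cfg U₁) μ (O (cfg U₁) (cdsS i (cfg U₁) ν (liftY f (E : 𝔸))))),
            ⨆ μ : Fin (d + 1), ⨆ ν : Fin (d + 1), l2OfY hh (cdS i (cfg U₁) μ (cdS i (cfg U₁) ν (O (cfg U₁) (liftY f (E : 𝔸))))),
            ⨆ μ : Fin (d + 1), ⨆ ν : Fin (d + 1),
              l2OfY hh (O (cfg U₁) (cdsS i (cfg U₁) μ (cdsS i (cfg U₁) ν (liftY f (E : 𝔸)))))] : Fin 6 → ℝ) 3)) ≤ c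
        simp only [vec6_three, pow_zero, one_mul]
        refine iSup_ball_le (fun E => Real.iSup_le (fun μ => Real.iSup_le (fun ν => ?_) hc) hc) hc
        have hx' := le_trans (sum_bl2_member_mul_le' (g := geo9K i) (R' := R) (H' := H) (blkSK (κ := κ) i sI) _
          (evSK i (Sum.inl f)) (nbr (geo9K i) r y) (geo9K_cutSup_nonneg i (Sum.inl hh)) (μ, ν)) hx
        dsimp only at hx'
        rw [pairS3_eq, evSK_inl] at hx'
        exact l2OfY_le_of_coordModelS i b hσ1 hr
          (fun _ : Fin (d + 1) => (cdSL i (cfg U₁) μ).restrictScalars ℝ ∘ₗ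
            ((O (cfg U₁)).restrictScalars ℝ ∘ₗ (cdsSL i (cfg U₁) ν).restrictScalars ℝ)) f hh y (hcut_dist i hcut) hx' E 0

/-- ★★ **ENTRY 4 — `L2ReadsNbr … 4 U₁ (RelB i) r √((d+1)|κ|) (blkSK sI ∘ fst) (blkSK sI) evSK (familyOp fun p => (DdS p.1 ∘ₗ DdS p.2) ∘ₗ GcoS)`**: the member
`sup_{μ,ν} ‖h∇_{U,μ}∇_{U,ν}O(f ⊗ E)‖₂`, pair by pair. [cite: Balaban1985BackgroundPropagators, (3.46) p.398 (∇_U∇_UG′ member) + (3.39) p.397; Balaban1984PropagatorsII, (2.51)–(2.52) p.232, (2.54) p.233] -/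
theorem l2ReadsNbr_kernelFamilyS_coords_four [Fintype (geo9K i).Site] [DecidableRel (RelB i)]
    (hσI : ∀ (z : SiteY i) (c : IBondY i), blkOf i.D.toDomains z = β i.hN i.D i.hk c → β i.hN i.D i.hk (sI z) = blkOf i.D.toDomains z)
    (hσ1 : ∀ z : SiteY i, (geomT i.D).dist (β i.hN i.D i.hk (sI z)) (blkOf i.D.toDomains z) ≤ 1) {r : ℝ} (hr : 2 ≤ r) :
    L2ReadsNbr (R := R) (H := H) (kernelFamilyS i B cfg O par) 4 U₁ (RelB i) r (Real.sqrt ((d + 1) * Fintype.card κ))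
      (blkSK i sI ∘ Prod.fst) (blkSK i sI) (evSK i)
      (familyOp fun p : Fin (d + 1) × Fin (d + 1) =>
        (((etaS i)⁻¹ • coordOpK b (fun _ : Fin (d + 1) => (cdSL i (cfg U₁) p.1).restrictScalars ℝ)) ∘ₗ
            ((etaS i)⁻¹ • coordOpK b (fun _ : Fin (d + 1) => (cdSL i (cfg U₁) p.2).restrictScalars ℝ))) ∘ₗ GcoS i b B cfg O U₁) := by
  obtain ⟨h1, h2, h3, h4⟩ := fields (R := R) (H := H) (κ := κ) i hσI
  refine ⟨h1, h2, h3, h4, ?_⟩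
  intro lam h y c hc hcut hx
  cases lam with
  | inr J => cases h with
    | inl z => exact hc
    | inr hh => exact hc
  | inl f => cases h with
    | inr hh => exact hc
    | inl hh =>
        show etaS i ^ ((![2, 1, 1, 0, 0, 0] : Fin 6 → ℕ) 4) * (⨆ E : BallY 𝔸, ((![l2OfY hh (O (cfg U₁) (liftY f (E : 𝔸))),
            ⨆ μ : Fin (d + 1), l2OfY hh (cdS i (cfg U₁) μ (O (cfg U₁) (liftY f (E : 𝔸)))),
            ⨆ μ : Fin (d + 1), l2OfY hh (O (cfg U₁) (cdsS i (cfg U₁) μ (liftY f (E : 𝔸)))),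
            ⨆ μ : Fin (d + 1), ⨆ ν : Fin (d + 1), l2OfY hh (cdS i (cfg U₁) μ (O (cfg U₁) (cdsS i (cfg U₁) ν (liftY f (E : 𝔸))))),
            ⨆ μ : Fin (d + 1), ⨆ ν : Fin (d + 1), l2OfY hh (cdS i (cfg U₁) μ (cdS i (cfg U₁) ν (O (cfg U₁) (liftY f (E : 𝔸))))),
            ⨆ μ : Fin (d + 1), ⨆ ν : Fin (d + 1),
              l2OfY hh (O (cfg U₁) (cdsS i (cfg U₁) μ (cdsS i (cfg U₁) ν (liftY f (E : 𝔸)))))] : Fin 6 → ℝ) 4)) ≤ c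
        simp only [vec6_four, pow_zero, one_mul]
        refine iSup_ball_le (fun E => Real.iSup_le (fun μ => Real.iSup_le (fun ν => ?_) hc) hc) hc
        have hx' := le_trans (sum_bl2_member_mul_le' (g := geo9K i) (R' := R) (H' := H) (blkSK (κ := κ) i sI) _
          (evSK i (Sum.inl f)) (nbr (geo9K i) r y) (geo9K_cutSup_nonneg i (Sum.inl hh)) (μ, ν)) hx
        dsimp only at hx'
        rw [pairS4_eq, evSK_inl] at hx'
        exact l2OfY_le_of_coordModelS i b hσ1 hr
          (fun _ : Fin (d + 1) => ((cdSL i (cfg U₁) μ).restrictScalars ℝ ∘ₗ (cdSL i (cfg U₁) ν).restrictScalars ℝ) ∘ₗ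
            (O (cfg U₁)).restrictScalars ℝ) f hh y (hcut_dist i hcut) hx' E 0

/-- ★★ **ENTRY 5 — `L2ReadsNbr … 5 U₁ (RelB i) r √((d+1)|κ|) (blkSK sI ∘ fst) (blkSK sI) evSK (familyOp fun p => GcoS ∘ₗ (DsdS p.1 ∘ₗ DsdS p.2))`**: the member
`sup_{μ,ν} ‖hO∇\*_{U,μ}∇\*_{U,ν}(f ⊗ E)‖₂`, pair by pair. [cite: Balaban1985BackgroundPropagators, (3.46) p.398 (G′∇\*_U∇\*_U member) + (3.39) p.397; Balaban1984PropagatorsII, (2.51)–(2.52) p.232, (2.54) p.233] -/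
theorem l2ReadsNbr_kernelFamilyS_coords_five [Fintype (geo9K i).Site] [DecidableRel (RelB i)]
    (hσI : ∀ (z : SiteY i) (c : IBondY i), blkOf i.D.toDomains z = β i.hN i.D i.hk c → β i.hN i.D i.hk (sI z) = blkOf i.D.toDomains z)
    (hσ1 : ∀ z : SiteY i, (geomT i.D).dist (β i.hN i.D i.hk (sI z)) (blkOf i.D.toDomains z) ≤ 1) {r : ℝ} (hr : 2 ≤ r) :
    L2ReadsNbr (R := R) (H := H) (kernelFamilyS i B cfg O par) 5 U₁ (RelB i) r (Real.sqrt ((d + 1) * Fintype.card κ))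
      (blkSK i sI ∘ Prod.fst) (blkSK i sI) (evSK i)
      (familyOp fun p : Fin (d + 1) × Fin (d + 1) =>
        GcoS i b B cfg O U₁ ∘ₗ
          (((etaS i)⁻¹ • coordOpK b (fun _ : Fin (d + 1) => (cdsSL i (cfg U₁) p.1).restrictScalars ℝ)) ∘ₗ
            ((etaS i)⁻¹ • coordOpK b (fun _ : Fin (d + 1) => (cdsSL i (cfg U₁) p.2).restrictScalars ℝ)))) := by
  obtain ⟨h1, h2, h3, h4⟩ := fields (R := R) (H := H) (κ := κ) i hσI
  refine ⟨h1, h2, h3, h4, ?_⟩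
  intro lam h y c hc hcut hx
  cases lam with
  | inr J => cases h with
    | inl z => exact hc
    | inr hh => exact hc
  | inl f => cases h with
    | inr hh => exact hc
    | inl hh =>
        show etaS i ^ ((![2, 1, 1, 0, 0, 0] : Fin 6 → ℕ) 5) * (⨆ E : BallY 𝔸, ((![l2OfY hh (O (cfg U₁) (liftY f (E : 𝔸))),
            ⨆ μ : Fin (d + 1), l2OfY hh (cdS i (cfg U₁) μ (O (cfg U₁) (liftY f (E : 𝔸)))),
            ⨆ μ : Fin (d + 1), l2OfY hh (O (cfg U₁) (cdsS i (cfg U₁) μ (liftY f (E : 𝔸)))),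
            ⨆ μ : Fin (d + 1), ⨆ ν : Fin (d + 1), l2OfY hh (cdS i (cfg U₁) μ (O (cfg U₁) (cdsS i (cfg U₁) ν (liftY f (E : 𝔸))))),
            ⨆ μ : Fin (d + 1), ⨆ ν : Fin (d + 1), l2OfY hh (cdS i (cfg U₁) μ (cdS i (cfg U₁) ν (O (cfg U₁) (liftY f (E : 𝔸))))),
            ⨆ μ : Fin (d + 1), ⨆ ν : Fin (d + 1),
              l2OfY hh (O (cfg U₁) (cdsS i (cfg U₁) μ (cdsS i (cfg U₁) ν (liftY f (E : 𝔸)))))] : Fin 6 → ℝ) 5)) ≤ c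
        simp only [vec6_five, pow_zero, one_mul]
        refine iSup_ball_le (fun E => Real.iSup_le (fun μ => Real.iSup_le (fun ν => ?_) hc) hc) hc
        have hx' := le_trans (sum_bl2_member_mul_le' (g := geo9K i) (R' := R) (H' := H) (blkSK (κ := κ) i sI) _
          (evSK i (Sum.inl f)) (nbr (geo9K i) r y) (geo9K_cutSup_nonneg i (Sum.inl hh)) (μ, ν)) hx
        dsimp only at hx'
        rw [pairS5_eq, evSK_inl] at hx'
        exact l2OfY_le_of_coordModelS i b hσ1 hr
          (fun _ : Fin (d + 1) => (O (cfg U₁)).restrictScalars ℝ ∘ₗ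
            ((cdsSL i (cfg U₁) μ).restrictScalars ℝ ∘ₗ (cdsSL i (cfg U₁) ν).restrictScalars ℝ)) f hh y (hcut_dist i hcut) hx' E 0

/-- ★★ **THE KNIT'S ONE-LINER, LINES 0–2 OF THE SITE SECTOR UNDER THE PINS**: walk letters with `blk = blkY = blkSK sI`, `G = GcoS b O cfg U₁`, `D = DcoS`, `Ds = DscoS`
⇒ the co-readings `L2ReadsNbr (kernelFamilyS …) n U₁ (RelB i) 2 √((d+1)|κ|) …` of `G`, `D ∘ₗ G` (bu = blkY), `G ∘ₗ Ds` (bv = blkY) HOLD.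
[cite: Balaban1985BackgroundPropagators, (3.46) p.398; Balaban1984PropagatorsII, (2.51)–(2.54) pp.232–233, (2.67) p.234] -/
theorem site_l2ReadsNbr012_of_pins [Fintype (geo9K i).Site] [DecidableRel (RelB i)]
    (hσI : ∀ (z : SiteY i) (c : IBondY i), blkOf i.D.toDomains z = β i.hN i.D i.hk c → β i.hN i.D i.hk (sI z) = blkOf i.D.toDomains z)
    (hσ1 : ∀ z : SiteY i, (geomT i.D).dist (β i.hN i.D i.hk (sI z)) (blkOf i.D.toDomains z) ≤ 1)
    {blk blkY : XSK κ i → IBondY i} {G D Ds : (XSK κ i → ℝ) →ₗ[ℝ] (XSK κ i → ℝ)} (hblk : blk = blkSK i sI) (hblkY : blkY = blkSK i sI)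
    (hG : G = GcoS i b B cfg O U₁) (hD : D = DcoS i b B cfg U₁) (hDs : Ds = DscoS i b B cfg U₁) :
    L2ReadsNbr (R := R) (H := H) (kernelFamilyS i B cfg O par) 0 U₁ (RelB i) 2 (Real.sqrt ((d + 1) * Fintype.card κ)) blk blk (evSK i) G ∧
      L2ReadsNbr (R := R) (H := H) (kernelFamilyS i B cfg O par) 1 U₁ (RelB i) 2 (Real.sqrt ((d + 1) * Fintype.card κ)) blkY blk (evSK i) (D ∘ₗ G) ∧
      L2ReadsNbr (R := R) (H := H) (kernelFamilyS i B cfg O par) 2 U₁ (RelB i) 2 (Real.sqrt ((d + 1) * Fintype.card κ)) blk blkY (evSK i) (G ∘ₗ Ds) := by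
  subst hblk hblkY hG hD hDs
  exact ⟨l2ReadsNbr_kernelFamilyS_coords_zero i b B cfg O par U₁ hσI hσ1 le_rfl,
    l2ReadsNbr_kernelFamilyS_coords_one i b B cfg O par U₁ hσI hσ1 le_rfl,
    l2ReadsNbr_kernelFamilyS_coords_two i b B cfg O par U₁ hσI hσ1 le_rfl⟩

/-- ★★ **THE KNIT'S ONE-LINER, LINES 3–5 OF THE SITE SECTOR UNDER THE PINS**: walk letters with `blk = blkSK sI`, `G = GcoS b O cfg U₁`, single-direction letters
`Dd μ = η⁻¹ • coordOpK b (fun _ => ∇_{U,μ})`, `Dsd μ = η⁻¹ • coordOpK b (fun _ => ∇\*_{U,μ})` (n06-d's `DdS ∕ DsdS`) ⇒ the co-readings of the MIXED family (n = 3), the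
∇∇ family (n = 4) and the ∇\*∇\* family (n = 5) HOLD. [cite: Balaban1985BackgroundPropagators, (3.46) p.398, (3.39) p.397; Balaban1984PropagatorsII, (2.51)–(2.54) pp.232–233, (2.67) p.234] -/
theorem site_l2ReadsNbr345_of_pins [Fintype (geo9K i).Site] [DecidableRel (RelB i)]
    (hσI : ∀ (z : SiteY i) (c : IBondY i), blkOf i.D.toDomains z = β i.hN i.D i.hk c → β i.hN i.D i.hk (sI z) = blkOf i.D.toDomains z)
    (hσ1 : ∀ z : SiteY i, (geomT i.D).dist (β i.hN i.D i.hk (sI z)) (blkOf i.D.toDomains z) ≤ 1)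
    {blk : XSK κ i → IBondY i} {G : (XSK κ i → ℝ) →ₗ[ℝ] (XSK κ i → ℝ)} {Dd Dsd : Fin (d + 1) → ((XSK κ i → ℝ) →ₗ[ℝ] (XSK κ i → ℝ))}
    (hblk : blk = blkSK i sI) (hG : G = GcoS i b B cfg O U₁)
    (hDd : Dd = fun μ => (etaS i)⁻¹ • coordOpK b (fun _ : Fin (d + 1) => (cdSL i (cfg U₁) μ).restrictScalars ℝ))
    (hDsd : Dsd = fun μ => (etaS i)⁻¹ • coordOpK b (fun _ : Fin (d + 1) => (cdsSL i (cfg U₁) μ).restrictScalars ℝ)) :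
    L2ReadsNbr (R := R) (H := H) (kernelFamilyS i B cfg O par) 3 U₁ (RelB i) 2 (Real.sqrt ((d + 1) * Fintype.card κ)) (blk ∘ Prod.fst) blk (evSK i)
        (familyOp fun p : Fin (d + 1) × Fin (d + 1) => Dd p.1 ∘ₗ (G ∘ₗ Dsd p.2)) ∧
      L2ReadsNbr (R := R) (H := H) (kernelFamilyS i B cfg O par) 4 U₁ (RelB i) 2 (Real.sqrt ((d + 1) * Fintype.card κ)) (blk ∘ Prod.fst) blk (evSK i)
        (familyOp fun p : Fin (d + 1) × Fin (d + 1) => (Dd p.1 ∘ₗ Dd p.2) ∘ₗ G) ∧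
      L2ReadsNbr (R := R) (H := H) (kernelFamilyS i B cfg O par) 5 U₁ (RelB i) 2 (Real.sqrt ((d + 1) * Fintype.card κ)) (blk ∘ Prod.fst) blk (evSK i)
        (familyOp fun p : Fin (d + 1) × Fin (d + 1) => G ∘ₗ (Dsd p.1 ∘ₗ Dsd p.2)) := by
  subst hblk hG hDd hDsd
  exact ⟨l2ReadsNbr_kernelFamilyS_coords_three i b B cfg O par U₁ hσI hσ1 le_rfl,
    l2ReadsNbr_kernelFamilyS_coords_four i b B cfg O par U₁ hσI hσ1 le_rfl,
    l2ReadsNbr_kernelFamilyS_coords_five i b B cfg O par U₁ hσI hσ1 le_rfl⟩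

end L2

end Literature.MathematicalPhysics.QuantumFieldTheory.Balaban1983to89.B9CoReadingCoordsL2S

end
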